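import Mathlib.LinearAlgebra.Matrix.ToLin
import Mathlib.LinearAlgebra.FiniteDimensional.Lemmas
import Literature.Computability.AlgebraicComplexity.QuantumFunctionalsDegenerationProofs
import HarnessLib

/-!
# Linear algebra for Strassen's support functionals: trilinearity, composition, echelon rows

Topic `Literature/Computability/AlgebraicComplexity`. Elementary linear algebra behind the
monotonicity of Strassen's upper support functional under restriction ([Str91, §2]; CVZ 2023,
Thm. 2.4 (4), Prop. 2.6): the action `(A ⊗ B ⊗ C)·t` (`actTensor`, `QuantumFunctionals.lean`) is
trilinear in the rows of `A, B, C` (and functorial: `actTensor_actTensor`,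
`QuantumFunctionalsDegenerationProofs.lean`), rows can be expressed in any spanning family, and
every matrix can be brought — by an invertible (here: spanning) change of rows — into *row echelon
form*: the nonzero rows have strictly increasing pivots and vanish to the left of their pivot.

## Content (all proved, no definitions)

* `sum₃_linear₁/₂/₃` — trilinearity of `(u, v, w) ↦ ∑_{a,b,c} u_a v_b w_c t_{abc}` in each argument
  (functoriality `(X ⊗ Y ⊗ Z)·((A ⊗ B ⊗ C)·t) = (XA ⊗ YB ⊗ ZC)·t` is `actTensor_actTensor` of
  `QuantumFunctionalsDegenerationProofs.lean`, imported).
* `exists_matrix_mul_eq_of_span_rows_eq_top` — if the rows of `A` span, every `X` factors as `X̂ A`.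
* `actTensor_reindex`, `span_rows_reindex_eq_top` — permutation (reindexing) matrices act by
  precomposition and have spanning rows.
* `exists_echelon_family` — every subspace of `K^N` is spanned by a family in echelon form
  (strictly increasing pivots, zeros left of the pivot, nonzero pivot entries);
  `exists_echelon_rows` — for every `X ∈ K^{ι' × N}` there is `U ∈ K^{(r+s) × ι'}` with spanning
  rows such that the first `r` rows of `U X` are in echelon form and the last `s` rows vanish
  (Gaussian elimination; the rows of `U` are coefficient vectors of an echelon basis of the row
  space followed by a basis of the left kernel).

## References

* V. Strassen, J. reine angew. Math. 413 (1991), §2 — cited through CVZ.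
* M. Christandl, P. Vrana, J. Zuiddam, J. Amer. Math. Soc. 36 (2023), §2. [ChristandlVranaZuiddam2023]
-/

noncomputable section

open scoped BigOperators

namespace Literature.Computability.AlgebraicComplexity

/-! ## Trilinearity of the evaluation `∑ u_a v_b w_c t_{abc}` -/

section Trilinear

variable {K : Type*} [CommSemiring K] {ι κ μ : Type*} [Fintype ι] [Fintype κ] [Fintype μ]

/-- Moving a finite sum outside a triple sum. [folklore] -/
theorem sum₃_sum_comm {ρ : Type*} [Fintype ρ] (F : ι → κ → μ → ρ → K) :
    (∑ a, ∑ b, ∑ c, ∑ j, F a b c j) = ∑ j, ∑ a, ∑ b, ∑ c, F a b c j := by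
  calc (∑ a, ∑ b, ∑ c, ∑ j, F a b c j) = ∑ p : ι × κ × μ, ∑ j, F p.1 p.2.1 p.2.2 j := by
        simp only [Fintype.sum_prod_type]
    _ = ∑ j, ∑ p : ι × κ × μ, F p.1 p.2.1 p.2.2 j := Finset.sum_comm
    _ = ∑ j, ∑ a, ∑ b, ∑ c, F a b c j := by simp only [Fintype.sum_prod_type]

/-- Trilinearity in the first argument: `∑_{abc} (∑ⱼ λⱼ uⱼ(a)) v(b) w(c) t_{abc} =
∑ⱼ λⱼ ∑_{abc} uⱼ(a) v(b) w(c) t_{abc}`. [folklore] -/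
theorem sum₃_linear₁ {ρ : Type*} [Fintype ρ] (lam : ρ → K) (u : ρ → ι → K) (v : κ → K) (w : μ → K)
    (t : ι → κ → μ → K) :
    (∑ a, ∑ b, ∑ c, (∑ j, lam j * u j a) * v b * w c * t a b c) =
      ∑ j, lam j * ∑ a, ∑ b, ∑ c, u j a * v b * w c * t a b c := by
  have h : ∀ a b c, (∑ j, lam j * u j a) * v b * w c * t a b c =
      ∑ j, lam j * (u j a * v b * w c * t a b c) := by
    intro a b c
    rw [Finset.sum_mul, Finset.sum_mul, Finset.sum_mul]
    exact Finset.sum_congr rfl fun j _ => by ring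
  simp only [h]
  rw [sum₃_sum_comm]
  simp only [Finset.mul_sum]

/-- Trilinearity in the second argument. [folklore] -/
theorem sum₃_linear₂ {ρ : Type*} [Fintype ρ] (lam : ρ → K) (u : ι → K) (v : ρ → κ → K) (w : μ → K)
    (t : ι → κ → μ → K) :
    (∑ a, ∑ b, ∑ c, u a * (∑ j, lam j * v j b) * w c * t a b c) =
      ∑ j, lam j * ∑ a, ∑ b, ∑ c, u a * v j b * w c * t a b c := by
  have h : ∀ a b c, u a * (∑ j, lam j * v j b) * w c * t a b c =
      ∑ j, lam j * (u a * v j b * w c * t a b c) := by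
    intro a b c
    rw [Finset.mul_sum, Finset.sum_mul, Finset.sum_mul]
    exact Finset.sum_congr rfl fun j _ => by ring
  simp only [h]
  rw [sum₃_sum_comm]
  simp only [Finset.mul_sum]

/-- Trilinearity in the third argument. [folklore] -/
theorem sum₃_linear₃ {ρ : Type*} [Fintype ρ] (lam : ρ → K) (u : ι → K) (v : κ → K) (w : ρ → μ → K)
    (t : ι → κ → μ → K) :
    (∑ a, ∑ b, ∑ c, u a * v b * (∑ j, lam j * w j c) * t a b c) =
      ∑ j, lam j * ∑ a, ∑ b, ∑ c, u a * v b * w j c * t a b c := by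
  have h : ∀ a b c, u a * v b * (∑ j, lam j * w j c) * t a b c =
      ∑ j, lam j * (u a * v b * w j c * t a b c) := by
    intro a b c
    rw [Finset.mul_sum, Finset.sum_mul]
    exact Finset.sum_congr rfl fun j _ => by ring
  simp only [h]
  rw [sum₃_sum_comm]
  simp only [Finset.mul_sum]

end Trilinear

/-! ## Rows in a spanning family; reindexing matrices -/

section Rows

variable {K : Type*} [Field K] {ι ρ ι' : Type*} [Fintype ι] [Fintype ρ]

omit [Fintype ι] in
/-- If the rows of `A ∈ K^{ρ × ι}` span `K^ι`, every `X ∈ K^{ι' × ι}` factors as `X = X̂ A`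
(each row of `X` is a combination of the rows of `A`). [folklore] -/
theorem exists_matrix_mul_eq_of_span_rows_eq_top (A : Matrix ρ ι K)
    (hA : Submodule.span K (Set.range A.row) = ⊤) (X : Matrix ι' ι K) :
    ∃ Xh : Matrix ι' ρ K, X = Xh * A := by
  have hmem : ∀ i, X i ∈ Submodule.span K (Set.range A.row) := fun i => hA ▸ Submodule.mem_top
  choose c hc using fun i => (Submodule.mem_span_range_iff_exists_fun K).1 (hmem i)
  refine ⟨Matrix.of c, ?_⟩
  ext i a
  rw [Matrix.mul_apply]
  have h := congrFun (hc i) a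
  simp only [Finset.sum_apply, Pi.smul_apply, smul_eq_mul, Matrix.row] at h
  rw [← h]
  simp only [Matrix.of_apply]

variable [DecidableEq ι]

omit [Fintype ρ] in
/-- The reindexing matrix of a map `σ : ρ → ι` (rows = the standard basis vectors `e_{σ a'}`) acts on
the first factor by precomposition with `σ`; similarly for all three factors at once. [folklore] -/
theorem actTensor_reindex {κ μ κ₀ μ₀ : Type*} [Fintype κ] [Fintype μ] [DecidableEq κ]
    [DecidableEq μ] (σ : ρ → ι) (τ : κ₀ → κ) (υ : μ₀ → μ) (t : ι → κ → μ → K) :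
    actTensor (Matrix.of fun a' a => if a = σ a' then (1 : K) else 0)
      (Matrix.of fun b' b => if b = τ b' then (1 : K) else 0)
      (Matrix.of fun c' c => if c = υ c' then (1 : K) else 0) t =
      fun a' b' c' => t (σ a') (τ b') (υ c') := by
  funext a' b' c'
  rw [actTensor_apply]
  simp only [Matrix.of_apply]
  rw [Finset.sum_eq_single (σ a') (fun a _ ha => by simp [ha]) (by simp),
    Finset.sum_eq_single (τ b') (fun b _ hb => by simp [hb]) (by simp),
    Finset.sum_eq_single (υ c') (fun c _ hc => by simp [hc]) (by simp)]
  simp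

omit [Fintype ρ] in
/-- The rows of the reindexing matrix of a surjection `σ : ρ → ι` span `K^ι` (they are all the
standard basis vectors). [folklore] -/
theorem span_rows_reindex_eq_top {σ : ρ → ι} (hσ : Function.Surjective σ) :
    Submodule.span K (Set.range (Matrix.of fun a' a => if a = σ a' then (1 : K) else 0).row) = ⊤ := by
  refine Submodule.eq_top_iff'.2 fun y => ?_
  -- `y = ∑_a y a • e_a` and each `e_a` is a row
  have hy : y = ∑ a, y a • (Pi.single a (1 : K) : ι → K) := by
    funext i
    simp [Finset.sum_apply, Pi.single_apply]
  rw [hy]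
  refine Submodule.sum_mem _ fun a _ => Submodule.smul_mem _ _ (Submodule.subset_span ?_)
  obtain ⟨a', rfl⟩ := hσ a
  refine ⟨a', ?_⟩
  funext i
  simp only [Matrix.row, Matrix.of_apply, Pi.single_apply]

end Rows

/-! ## Echelon families and echelon rows -/

section Echelon

variable {K : Type*} [Field K] {N : ℕ}

/-- Prepending a smaller element to a strictly increasing tuple keeps it strictly increasing.
[folklore] -/
theorem strictMono_fin_cons {α : Type*} [Preorder α] {n : ℕ} {p : α} {π : Fin n → α}
    (hπ : StrictMono π) (hp : ∀ j, p < π j) : StrictMono (Fin.cons p π : Fin (n + 1) → α) := by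
  intro i j hij
  induction i using Fin.cases with
  | zero =>
    induction j using Fin.cases with
    | zero => exact (lt_irrefl _ hij).elim
    | succ j => simpa using hp j
  | succ i =>
    induction j using Fin.cases with
    | zero => exact absurd hij (not_lt.2 (Fin.zero_le _))
    | succ j => simpa using hπ (Fin.succ_lt_succ_iff.1 hij)

/-- **Echelon families**: every subspace `R ⊆ K^N` is spanned by a family `w₀, …, w_{r-1} ∈ R` with
strictly increasing *pivots* `π₀ < ⋯ < π_{r-1}` such that `wⱼ` vanishes at every coordinate left of
`πⱼ` and `wⱼ(πⱼ) ≠ 0` (Gaussian elimination: the first pivot is the least coordinate at which `R` is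
nonzero; recurse on `{v ∈ R | v(π₀) = 0}`, of smaller dimension). [folklore] -/
theorem exists_echelon_family (R : Submodule K (Fin N → K)) :
    ∃ (r : ℕ) (w : Fin r → Fin N → K) (π : Fin r → Fin N), StrictMono π ∧ (∀ j, w j ∈ R) ∧
      (∀ v ∈ R, v ∈ Submodule.span K (Set.range w)) ∧ (∀ j a, a < π j → w j a = 0) ∧
      ∀ j, w j (π j) ≠ 0 := by
  classical
  suffices h : ∀ n : ℕ, ∀ R : Submodule K (Fin N → K), Module.finrank K R ≤ n →
      ∃ (r : ℕ) (w : Fin r → Fin N → K) (π : Fin r → Fin N), StrictMono π ∧ (∀ j, w j ∈ R) ∧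
        (∀ v ∈ R, v ∈ Submodule.span K (Set.range w)) ∧ (∀ j a, a < π j → w j a = 0) ∧
        ∀ j, w j (π j) ≠ 0 from h _ R le_rfl
  -- the case `R = ⊥`
  have hbot : ∀ R : Submodule K (Fin N → K), R = ⊥ →
      ∃ (r : ℕ) (w : Fin r → Fin N → K) (π : Fin r → Fin N), StrictMono π ∧ (∀ j, w j ∈ R) ∧
        (∀ v ∈ R, v ∈ Submodule.span K (Set.range w)) ∧ (∀ j a, a < π j → w j a = 0) ∧
        ∀ j, w j (π j) ≠ 0 := by
    rintro R rfl
    refine ⟨0, fun j => Fin.elim0 j, fun j => Fin.elim0 j, fun j => Fin.elim0 j,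
      fun j => Fin.elim0 j, fun v hv => ?_, fun j => Fin.elim0 j, fun j => Fin.elim0 j⟩
    rw [(Submodule.mem_bot K).1 hv]
    exact Submodule.zero_mem _
  intro n
  induction n with
  | zero =>
    intro R hR
    exact hbot R (Submodule.finrank_eq_zero.1 (Nat.le_zero.1 hR))
  | succ n ih =>
    intro R hR
    by_cases hR0 : R = ⊥
    · exact hbot R hR0
    obtain ⟨v, hvR, hv0⟩ := Submodule.exists_mem_ne_zero_of_ne_bot hR0
    -- the least coordinate at which `R` does not vanish
    let S : Finset (Fin N) := Finset.univ.filter fun a => ∃ u ∈ R, u a ≠ 0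
    have hSmem : ∀ a, a ∈ S ↔ ∃ u ∈ R, u a ≠ 0 := fun a => by simp [S]
    obtain ⟨a₀, ha₀⟩ : ∃ a, v a ≠ 0 := Function.ne_iff.1 hv0
    have hSne : S.Nonempty := ⟨a₀, (hSmem a₀).2 ⟨v, hvR, ha₀⟩⟩
    set p := S.min' hSne with hp
    obtain ⟨u, huR, hup⟩ : ∃ u ∈ R, u p ≠ 0 := (hSmem p).1 (Finset.min'_mem S hSne)
    have hmin : ∀ u' ∈ R, ∀ a, a < p → u' a = 0 := by
      intro u' hu' a ha
      by_contra h
      exact (not_lt.2 (Finset.min'_le S a ((hSmem a).2 ⟨u', hu', h⟩))) ha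
    -- `R₁ = {x ∈ R | x p = 0}` has smaller dimension
    let R₁ : Submodule K (Fin N → K) := R ⊓ LinearMap.ker (LinearMap.proj p)
    have hR₁mem : ∀ x, x ∈ R₁ ↔ x ∈ R ∧ x p = 0 := fun x => by
      simp [R₁, LinearMap.mem_ker]
    have hR₁R : R₁ ≤ R := inf_le_left
    have hlt : R₁ < R := by
      refine lt_of_le_of_ne hR₁R fun h => hup ?_
      have hu₁ : u ∈ R₁ := h ▸ huR
      exact ((hR₁mem u).1 hu₁).2
    have hfin : Module.finrank K R₁ ≤ n :=
      Nat.lt_succ_iff.1 ((Submodule.finrank_lt_finrank_of_lt hlt).trans_le hR)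
    obtain ⟨r, w, π, hπ, hwR, hspan, hzero, hpiv⟩ := ih R₁ hfin
    have hπp : ∀ j, p < π j := by
      intro j
      by_contra h
      rcases (not_lt.1 h).lt_or_eq with hlt' | heq
      · exact hpiv j (hmin _ (hR₁R (hwR j)) _ hlt')
      · exact hpiv j (heq ▸ ((hR₁mem _).1 (hwR j)).2)
    refine ⟨r + 1, Fin.cons u w, Fin.cons p π, strictMono_fin_cons hπ hπp, ?_, ?_, ?_, ?_⟩
    · intro j
      induction j using Fin.cases with
      | zero => simpa using huR
      | succ j => simpa using hR₁R (hwR j)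
    · intro x hx
      -- `x - (x p / u p) • u ∈ R₁ ⊆ span w`, and `u`, `w j` are in the new family
      have hsub : ∀ y, y ∈ Submodule.span K (Set.range w) →
          y ∈ Submodule.span K (Set.range (Fin.cons u w : Fin (r + 1) → Fin N → K)) := by
        intro y hy
        refine Submodule.span_mono ?_ hy
        rw [Fin.range_cons]
        exact Set.subset_insert _ _
      have hu : u ∈ Submodule.span K (Set.range (Fin.cons u w : Fin (r + 1) → Fin N → K)) :=
        Submodule.subset_span ⟨0, by simp⟩
      have hx₁ : x - (x p / u p) • u ∈ R₁ := by
        refine (hR₁mem _).2 ⟨Submodule.sub_mem _ hx (Submodule.smul_mem _ _ huR), ?_⟩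
        simp only [Pi.sub_apply, Pi.smul_apply, smul_eq_mul]
        field_simp
        ring
      have hx₂ := hsub _ (hspan _ hx₁)
      have hx₃ : x = (x - (x p / u p) • u) + (x p / u p) • u := by abel
      rw [hx₃]
      exact Submodule.add_mem _ hx₂ (Submodule.smul_mem _ _ hu)
    · intro j
      induction j using Fin.cases with
      | zero =>
        intro a ha
        simp only [Fin.cons_zero] at ha ⊢
        exact hmin u huR a ha
      | succ j =>
        intro a ha
        simp only [Fin.cons_succ] at ha ⊢
        exact hzero j a ha
    · intro j
      induction j using Fin.cases with
      | zero => simpa using hup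
      | succ j => simpa using hpiv j

variable {ι' : Type*} [Fintype ι']

/-- **Echelon rows** (Gaussian elimination as a spanning change of rows): for every matrix
`X ∈ K^{ι' × N}` there are `U ∈ K^{(r+s) × ι'}` whose rows span `K^{ι'}` and strictly increasing
pivots `π₀ < ⋯ < π_{r-1}` such that row `j < r` of `U X` vanishes left of `πⱼ` and the last `s` rows
of `U X` vanish. (Rows of `U`: coefficient vectors of an echelon family spanning the row space of `X`,
followed by a basis of the left kernel of `X`.) This is the linear algebra behind the monotonicity of
Strassen's upper support functional under restriction ([Str91]; CVZ Thm. 2.4 (4), via the flag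
characterisation Prop. 2.6). [folklore] -/
theorem exists_echelon_rows (X : Matrix ι' (Fin N) K) :
    ∃ (r s : ℕ) (U : Matrix (Fin (r + s)) ι' K) (π : Fin r → Fin N),
      Submodule.span K (Set.range U.row) = ⊤ ∧ StrictMono π ∧
      (∀ j : Fin r, ∀ a : Fin N, a < π j → (U * X) (Fin.castAdd s j) a = 0) ∧
      (∀ j : Fin s, ∀ a : Fin N, (U * X) (Fin.natAdd r j) a = 0) := by
  classical
  obtain ⟨r, w, π, hπ, hwR, hspan, hzero, -⟩ :=
    exists_echelon_family (Submodule.span K (Set.range X.row))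
  -- coefficient vectors of the echelon family
  choose c hc using fun j => (Submodule.mem_span_range_iff_exists_fun K).1 (hwR j)
  have hcX : ∀ j a, (∑ i, c j i * X i a) = w j a := by
    intro j a
    have h := congrFun (hc j) a
    simpa only [Finset.sum_apply, Pi.smul_apply, smul_eq_mul, Matrix.row] using h
  -- a basis of the left kernel
  let L : Submodule K (ι' → K) := LinearMap.ker X.vecMulLinear
  have hLmem : ∀ y, y ∈ L ↔ ∀ a, (∑ i, y i * X i a) = 0 := by
    intro y
    simp only [L, LinearMap.mem_ker, Matrix.vecMulLinear_apply]
    constructor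
    · intro h a
      have := congrFun h a
      simpa [Matrix.vecMul, dotProduct] using this
    · intro h
      funext a
      simpa [Matrix.vecMul, dotProduct] using h a
  let b := Module.finBasis K L
  set s := Module.finrank K L with hs
  let k : Fin s → ι' → K := fun j => (b j : ι' → K)
  have hk : ∀ j, k j ∈ L := fun j => (b j).2
  refine ⟨r, s, Matrix.of (Fin.append c k), π, ?_, hπ, ?_, ?_⟩
  · -- the rows of `U` span
    refine Submodule.eq_top_iff'.2 fun y => ?_
    -- `y X ∈ row space = span w`: coefficients `d`
    have hyX : Matrix.vecMul y X ∈ Submodule.span K (Set.range X.row) :=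
      (Submodule.mem_span_range_iff_exists_fun K).2 ⟨y, (Matrix.vecMul_eq_sum y X).symm⟩
    obtain ⟨d, hd⟩ := (Submodule.mem_span_range_iff_exists_fun K).1 (hspan _ hyX)
    -- `y - ∑ d j • c j` lies in the left kernel
    have hy' : y - ∑ j, d j • c j ∈ L := by
      rw [hLmem]
      intro a
      have h1 : (∑ i, (y - ∑ j, d j • c j) i * X i a) =
          (∑ i, y i * X i a) - ∑ j, d j * ∑ i, c j i * X i a := by
        simp only [Pi.sub_apply, Finset.sum_apply, Pi.smul_apply, smul_eq_mul, sub_mul,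
          Finset.sum_sub_distrib, Finset.sum_mul, Finset.mul_sum]
        congr 1
        rw [Finset.sum_comm]
        exact Finset.sum_congr rfl fun j _ => Finset.sum_congr rfl fun i _ => by ring
      rw [h1]
      have h2 : (∑ i, y i * X i a) = Matrix.vecMul y X a := by
        simp [Matrix.vecMul, dotProduct]
      have h3 := congrFun hd a
      simp only [Finset.sum_apply, Pi.smul_apply, smul_eq_mul] at h3
      rw [h2, ← h3]
      simp only [hcX, sub_self]
    -- expand `y - ∑ d j • c j` in the kernel basis
    have hy'' : y - ∑ j, d j • c j ∈ Submodule.span K (Set.range k) := by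
      have hrepr := b.sum_repr ⟨_, hy'⟩
      have hcoe := congrArg (fun z : L => (z : ι' → K)) hrepr
      simp only [Submodule.coe_sum, Submodule.coe_smul] at hcoe
      rw [← hcoe]
      exact Submodule.sum_mem _ fun j _ => Submodule.smul_mem _ _ (Submodule.subset_span ⟨j, rfl⟩)
    have hrows : ∀ z, z ∈ Set.range c ∪ Set.range k →
        z ∈ Set.range (Matrix.of (Fin.append c k) : Matrix (Fin (r + s)) ι' K).row := by
      rintro z (⟨j, rfl⟩ | ⟨j, rfl⟩)
      · exact ⟨Fin.castAdd s j, funext fun i => by simp [Matrix.row, Fin.append_left]⟩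
      · exact ⟨Fin.natAdd r j, funext fun i => by simp [Matrix.row, Fin.append_right]⟩
    have hsub₁ : Submodule.span K (Set.range k) ≤
        Submodule.span K (Set.range (Matrix.of (Fin.append c k) : Matrix (Fin (r + s)) ι' K).row) :=
      Submodule.span_mono fun z hz => hrows z (Or.inr hz)
    have hc_mem : ∀ j, c j ∈
        Submodule.span K (Set.range (Matrix.of (Fin.append c k) : Matrix (Fin (r + s)) ι' K).row) :=
      fun j => Submodule.subset_span (hrows _ (Or.inl ⟨j, rfl⟩))
    have hy₃ : y = (y - ∑ j, d j • c j) + ∑ j, d j • c j := by abel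
    rw [hy₃]
    exact Submodule.add_mem _ (hsub₁ hy'')
      (Submodule.sum_mem _ fun j _ => Submodule.smul_mem _ _ (hc_mem j))
  · -- echelon rows
    intro j a ha
    rw [Matrix.mul_apply]
    simp only [Matrix.of_apply, Fin.append_left]
    rw [hcX j a]
    exact hzero j a ha
  · -- kernel rows
    intro j a
    rw [Matrix.mul_apply]
    simp only [Matrix.of_apply, Fin.append_right]
    exact (hLmem _).1 (hk j) a

end Echelon

end Literature.Computability.AlgebraicComplexity

end
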